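import Summits.AtomisticToContinuum.Crystallization.Theorems.ExcessDecayLiouvilleSiteGeometry
import Summits.AtomisticToContinuum.Crystallization.Theorems.ExcessDecayLiouvilleFarField

/-!
# `ExcessDecayLiouville.HcpLiouville` (stmt-AtomisticToContinuum-9332), line `Sketch`: lattice sums over the site set

Summability bookkeeping over the reference site set `S = Sites₀ t A` of an admissible hcp datum
(`Adm₀ A`, `Inner₀ t A`; `S` is `23/25`-separated, `dist_sites_ge`), for the linear Caccioppoli step
(stub `stub_flatDifferences`) whose double `tsum`s run over `↥S × ↥S`:

* `flatDiff_countable_sites₀`, `add_mem_sites₀` / `sub_mem_sites₀`, `flatDiff_finite_sites_ball` — countability,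
  `AΛ₀`-invariance, local finiteness;
* `flatDiff_sum_inv_pow_sites_far_le`, `flatDiff_sum_inv_pow_sites_le`, `flatDiff_summable_inv_pow_sites` — the far-field bound
  `Σ_{q : R ≤ |p−q|} |p − q|^{-(k+3)} ≤ 1024/((23/25)³Rᵏ)` of `ExcessDecayLiouvilleFarField` transported
  to `↥S`-indexed partial sums, and the summability of `q ↦ |p − q|^{-(k+3)}` off the diagonal;
* `flatDiff_summable_uncurry_of_left_finset` / `…_right_finset` — a family on `ι × ι` supported on
  `F × ι` (resp. `ι × F`), `F` finite, with summable fibres is summable;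
* the piecewise-linear radial cut-off `χ(x) = max 0 (min 1 (2 − dist x c / R))`: values in `[0,1]`,
  `= 1` on `B_R(c)`, `= 0` off `B_{2R}(c)`, `|χ x − χ y| ≤ dist x y / R`.

All `[folklore]`; a `--supports` helper for item stmt-AtomisticToContinuum-9332, nothing here closes
an item.
-/

noncomputable section

namespace Summit.AtomisticToContinuum.Crystallization.Theorems.ExcessDecayLiouville

open scoped BigOperators Topology Classical InnerProductSpace
open Literature.MathematicalPhysics.StatisticalMechanics
open Summit.AtomisticToContinuum.Crystallization.Theses.ExcessDecayLiouville
open Summit.AtomisticToContinuum.Crystallization.Theorems.PhononStabilityNegative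

/-! ## The site set: countable, `AΛ₀`-invariant, locally finite -/

/-- The site set is countable (an image of `Fin 2 × ℤ³`). [folklore] -/
theorem flatDiff_countable_sites₀ (t : Fin 2 → (EuclideanSpace ℝ (Fin 3))) (A : (EuclideanSpace ℝ (Fin 3)) →L[ℝ] (EuclideanSpace ℝ (Fin 3))) : (Sites₀ t A).Countable := by
  have h : Sites₀ t A ⊆ Set.range (fun v : Fin 2 × ℤ × ℤ × ℤ =>
      t v.1 + A ((v.2.1 : ℝ) • triangularVec₁ 1 + (v.2.2.1 : ℝ) • triangularVec₂ 1 +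
        (v.2.2.2 : ℝ) • layerNormal (2 * Real.sqrt (2 / 3)))) := by
    rintro p ⟨m, z, ⟨i, j, k, rfl⟩, rfl⟩
    exact ⟨(m, i, j, k), rfl⟩
  exact (Set.countable_range _).mono h

/-- Local finiteness on the subtype: only finitely many sites lie in a closed ball. [folklore] -/
theorem flatDiff_finite_sites_ball {t : Fin 2 → (EuclideanSpace ℝ (Fin 3))} {A : (EuclideanSpace ℝ (Fin 3)) →L[ℝ] (EuclideanSpace ℝ (Fin 3))} (hA : Adm₀ A) (hI : Inner₀ t A)
    (x : (EuclideanSpace ℝ (Fin 3))) (r : ℝ) : {q : Sites₀ t A | dist (q : (EuclideanSpace ℝ (Fin 3))) x ≤ r}.Finite := by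
  have h : {q : Sites₀ t A | dist (q : (EuclideanSpace ℝ (Fin 3))) x ≤ r} =
      Subtype.val ⁻¹' {s : (EuclideanSpace ℝ (Fin 3)) | s ∈ Sites₀ t A ∧ dist s x ≤ r} := by
    ext q; simp
  rw [h]
  exact (finite_sites_dist_le hA hI x r).preimage Subtype.val_injective.injOn

/-! ## Inverse-power sums over the site set -/

/-- **Far-field partial sums over sites**: for any point `p`, `R ≥ 23/25`, `k ≥ 1` and any finite set of
sites, `Σ_{q : R ≤ dist p q} (dist p q)^{-(k+3)} ≤ 1024/((23/25)³ Rᵏ)`. [folklore] -/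
theorem flatDiff_sum_inv_pow_sites_far_le {t : Fin 2 → (EuclideanSpace ℝ (Fin 3))} {A : (EuclideanSpace ℝ (Fin 3)) →L[ℝ] (EuclideanSpace ℝ (Fin 3))} (hA : Adm₀ A) (hI : Inner₀ t A)
    (p : (EuclideanSpace ℝ (Fin 3))) {R : ℝ} (hR : 23 / 25 ≤ R) {k : ℕ} (hk : 1 ≤ k) (U : Finset (Sites₀ t A)) :
    ∑ q ∈ U, (if R ≤ dist p q then (dist p (q : (EuclideanSpace ℝ (Fin 3))))⁻¹ ^ (k + 3) else 0) ≤
      1024 / ((23 / 25) ^ 3 * R ^ k) := by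
  classical
  rw [← Finset.sum_filter]
  have h := sum_inv_pow_le_of_separated
    ((U.filter fun q : Sites₀ t A => R ≤ dist p q).map (Function.Embedding.subtype _)) p hk
    (by norm_num : (0 : ℝ) < 23 / 25) hR ?_ ?_
  · rw [Finset.sum_map] at h
    simpa only [Function.Embedding.coe_subtype, dist_comm p] using h
  · intro a ha b hb hab
    simp only [Finset.mem_map, Function.Embedding.coe_subtype] at ha hb
    obtain ⟨a', -, rfl⟩ := ha
    obtain ⟨b', -, rfl⟩ := hb
    exact dist_sites_ge hA hI a'.2 b'.2 hab
  · intro a ha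
    simp only [Finset.mem_map, Finset.mem_filter, Function.Embedding.coe_subtype] at ha
    obtain ⟨a', ⟨-, ha'⟩, rfl⟩ := ha
    rwa [dist_comm] at ha'

/-- **Off-diagonal partial sums over sites**: for a site `p`, `k ≥ 1` and any finite set of sites,
`Σ_{q ≠ p} (dist p q)^{-(k+3)} ≤ 1024/(23/25)^{k+3}`. [folklore] -/
theorem flatDiff_sum_inv_pow_sites_le {t : Fin 2 → (EuclideanSpace ℝ (Fin 3))} {A : (EuclideanSpace ℝ (Fin 3)) →L[ℝ] (EuclideanSpace ℝ (Fin 3))} (hA : Adm₀ A) (hI : Inner₀ t A)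
    {p : (EuclideanSpace ℝ (Fin 3))} (hp : p ∈ Sites₀ t A) {k : ℕ} (hk : 1 ≤ k) (U : Finset (Sites₀ t A)) :
    ∑ q ∈ U, (if p ≠ q then (dist p (q : (EuclideanSpace ℝ (Fin 3))))⁻¹ ^ (k + 3) else 0) ≤
      1024 / ((23 / 25) ^ 3 * (23 / 25) ^ k) := by
  refine le_trans (le_of_eq (Finset.sum_congr rfl fun q _ => ?_)) (flatDiff_sum_inv_pow_sites_far_le hA hI p le_rfl hk U)
  by_cases hpq : p = q
  · simp [hpq]
  · rw [if_pos hpq, if_pos (dist_sites_ge hA hI hp q.2 hpq)]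

/-- **Summability of inverse powers over the sites**: for a site `p` and `k ≥ 1`, the family
`q ↦ (dist p q)^{-(k+3)}` (off the diagonal) is summable over the sites, with sum
`≤ 1024/(23/25)^{k+3}`. [folklore] -/
theorem flatDiff_summable_inv_pow_sites {t : Fin 2 → (EuclideanSpace ℝ (Fin 3))} {A : (EuclideanSpace ℝ (Fin 3)) →L[ℝ] (EuclideanSpace ℝ (Fin 3))} (hA : Adm₀ A) (hI : Inner₀ t A)
    {p : (EuclideanSpace ℝ (Fin 3))} (hp : p ∈ Sites₀ t A) {k : ℕ} (hk : 1 ≤ k) :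
    Summable (fun q : Sites₀ t A => if p ≠ q then (dist p (q : (EuclideanSpace ℝ (Fin 3))))⁻¹ ^ (k + 3) else 0) ∧
      ∑' q : Sites₀ t A, (if p ≠ q then (dist p (q : (EuclideanSpace ℝ (Fin 3))))⁻¹ ^ (k + 3) else 0) ≤
        1024 / ((23 / 25) ^ 3 * (23 / 25) ^ k) := by
  have hnn : ∀ q : Sites₀ t A, 0 ≤ (if p ≠ q then (dist p (q : (EuclideanSpace ℝ (Fin 3))))⁻¹ ^ (k + 3) else 0) :=
    fun q => by split_ifs <;> positivity
  have hs : Summable (fun q : Sites₀ t A => if p ≠ q then (dist p (q : (EuclideanSpace ℝ (Fin 3))))⁻¹ ^ (k + 3) else 0) :=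
    summable_of_sum_le hnn (flatDiff_sum_inv_pow_sites_le hA hI hp hk)
  exact ⟨hs, hs.tsum_le_of_sum_le (flatDiff_sum_inv_pow_sites_le hA hI hp hk)⟩

/-! ## Families on `ι × ι` supported on finitely many rows or columns -/

/-- A family on `ι × ι` vanishing outside the rows indexed by a finite set `F`, with summable rows,
is summable. [folklore] -/
theorem flatDiff_summable_uncurry_of_left_finset {ι E : Type*} [NormedAddCommGroup E] (f : ι → ι → E)
    (F : Finset ι) (h0 : ∀ p, p ∉ F → ∀ q, f p q = 0) (hs : ∀ p ∈ F, Summable (f p)) :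
    Summable (Function.uncurry f) := by
  classical
  have key : Function.uncurry f = fun x : ι × ι => ∑ p ∈ F, (if x.1 = p then f p x.2 else 0) := by
    funext x
    obtain ⟨p, q⟩ := x
    simp only [Function.uncurry_apply_pair, Finset.sum_ite_eq]
    by_cases hp : p ∈ F
    · rw [if_pos hp]
    · rw [if_neg hp, h0 p hp q]
  rw [key]
  refine summable_sum fun p hp => ?_
  have hinj : Function.Injective (Prod.mk p : ι → ι × ι) := Prod.mk_right_injective p
  refine (hinj.summable_iff ?_).1 ?_
  · intro x hx
    have hx1 : x.1 ≠ p := by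
      rintro rfl
      exact hx ⟨x.2, rfl⟩
    simp [hx1]
  · have heq : ((fun x : ι × ι => if x.1 = p then f p x.2 else 0) ∘ Prod.mk p) = f p := by
      funext q; simp
    rw [heq]
    exact hs p hp

/-- A family on `ι × ι` vanishing outside the columns indexed by a finite set `F`, with summable
columns, is summable. [folklore] -/
theorem flatDiff_summable_uncurry_of_right_finset {ι E : Type*} [NormedAddCommGroup E] (f : ι → ι → E)
    (F : Finset ι) (h0 : ∀ q, q ∉ F → ∀ p, f p q = 0) (hs : ∀ q ∈ F, Summable (fun p => f p q)) :
    Summable (Function.uncurry f) := by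
  have h := (flatDiff_summable_uncurry_of_left_finset (fun q p => f p q) F h0 hs).prod_symm
  exact h

/-! ## The radial cut-off -/

/-- The cut-off takes values in `[0, 1]`: lower bound. [folklore] -/
theorem flatDiff_cutoff_nonneg (c : (EuclideanSpace ℝ (Fin 3))) (R : ℝ) (x : (EuclideanSpace ℝ (Fin 3))) : 0 ≤ max 0 (min 1 (2 - dist x c / R)) :=
  le_max_left _ _

/-- The cut-off takes values in `[0, 1]`: upper bound. [folklore] -/
theorem flatDiff_cutoff_le_one (c : (EuclideanSpace ℝ (Fin 3))) (R : ℝ) (x : (EuclideanSpace ℝ (Fin 3))) : max 0 (min 1 (2 - dist x c / R)) ≤ 1 :=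
  max_le zero_le_one (min_le_left _ _)

/-- The cut-off is `1` on the closed ball of radius `R`. [folklore] -/
theorem flatDiff_cutoff_eq_one {c : (EuclideanSpace ℝ (Fin 3))} {R : ℝ} (hR : 0 < R) {x : (EuclideanSpace ℝ (Fin 3))} (hx : dist x c ≤ R) :
    max 0 (min 1 (2 - dist x c / R)) = 1 := by
  have h1 : dist x c / R ≤ 1 := (div_le_one hR).2 hx
  rw [min_eq_left (by linarith), max_eq_right zero_le_one]

/-- The cut-off vanishes off the ball of radius `2R`. [folklore] -/
theorem flatDiff_cutoff_eq_zero {c : (EuclideanSpace ℝ (Fin 3))} {R : ℝ} (hR : 0 < R) {x : (EuclideanSpace ℝ (Fin 3))} (hx : 2 * R ≤ dist x c) :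
    max 0 (min 1 (2 - dist x c / R)) = 0 := by
  have h1 : 2 ≤ dist x c / R := (le_div_iff₀ hR).2 hx
  exact max_eq_left ((min_le_right _ _).trans (by linarith))

/-- The cut-off is `1/R`-Lipschitz. [folklore] -/
private theorem abs_cutoff_sub_le {c : (EuclideanSpace ℝ (Fin 3))} {R : ℝ} (hR : 0 < R) (x y : (EuclideanSpace ℝ (Fin 3))) :
    |max 0 (min 1 (2 - dist x c / R)) - max 0 (min 1 (2 - dist y c / R))| ≤ dist x y / R := by
  have h1 := abs_max_sub_max_le_max (0 : ℝ) (min 1 (2 - dist x c / R)) 0 (min 1 (2 - dist y c / R))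
  have h2 := abs_min_sub_min_le_max (1 : ℝ) (2 - dist x c / R) 1 (2 - dist y c / R)
  simp only [sub_self, abs_zero] at h1 h2
  have h3 : |2 - dist x c / R - (2 - dist y c / R)| ≤ dist x y / R := by
    have : 2 - dist x c / R - (2 - dist y c / R) = (dist y c - dist x c) / R := by ring
    rw [this, abs_div, abs_of_pos hR]
    exact div_le_div_of_nonneg_right ((abs_dist_sub_le y x c).trans (dist_comm y x).le) hR.le
  have h0 : (0 : ℝ) ≤ dist x y / R := by positivity
  calc _ ≤ max 0 |min 1 (2 - dist x c / R) - min 1 (2 - dist y c / R)| := h1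
    _ ≤ max 0 (max 0 |2 - dist x c / R - (2 - dist y c / R)|) := by gcongr
    _ ≤ dist x y / R := max_le h0 (max_le h0 h3)

/-- Squared cut-off differences: `(χ x − χ y)² ≤ dist x y² / R²`. [folklore] -/
theorem flatDiff_cutoff_sub_sq_le {c : (EuclideanSpace ℝ (Fin 3))} {R : ℝ} (hR : 0 < R) (x y : (EuclideanSpace ℝ (Fin 3))) :
    (max 0 (min 1 (2 - dist x c / R)) - max 0 (min 1 (2 - dist y c / R))) ^ 2 ≤
      dist x y ^ 2 / R ^ 2 := by
  have h := abs_cutoff_sub_le hR x y (c := c)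
  rw [← sq_abs, ← div_pow]
  exact pow_le_pow_left₀ (abs_nonneg _) h 2

/-- Registered form of `flatDiff_summable_inv_pow_sites` (sub-goal of crux stmt-AtomisticToContinuum-9332,
line `Sketch`): inverse powers `(dist p q)^{-(k+3)}`, `k ≥ 1`, are summable over the sites off the
diagonal. [folklore] -/
theorem hcpLiouville_summable_inv_pow_sites : ∀ (t : Fin 2 → (EuclideanSpace ℝ (Fin 3))) (A : (EuclideanSpace ℝ (Fin 3)) →L[ℝ] (EuclideanSpace ℝ (Fin 3))), Adm₀ A → Inner₀ t A → ∀ p ∈ Sites₀ t A, ∀ k : ℕ, 1 ≤ k → Summable (fun q : Sites₀ t A => if p ≠ q then (dist p (q : (EuclideanSpace ℝ (Fin 3))))⁻¹ ^ (k + 3) else 0) := by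
  intro t A hA hI p hp k hk
  exact (flatDiff_summable_inv_pow_sites hA hI hp hk).1

end Summit.AtomisticToContinuum.Crystallization.Theorems.ExcessDecayLiouville

end
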